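import Summits.SmoothPoincare4.SmoothPoincare4.Theorems.SymplecticOrigamiGromovRecognitionRelEndGlueDefs
import Summits.SmoothPoincare4.SmoothPoincare4.Theorems.SymplecticOrigamiGromovRecognitionRelEndGluedBasics
import Literature.Topology.FourManifolds.ComplexProjectiveSpacePositiveAtlas
import Mathlib.Topology.Separation.Hausdorff

/-!
# Local image of an embedded two-chart sphere
(registered helpers `helper_embeddedLocalImage` (J7) and `helper_embeddedLocalImageInfty` (J7')
of line `cross-cap-laurent`, crux `GromovRecognitionRelEnd`, item stmt-SmoothPoincare4-11009)

For an EMBEDDED two-chart sphere `(u, v)` (`TwoChartSphere` + `IsEmbeddedPair`) in a Hausdorff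
manifold `X` and an open `V ⊆ ℂ`, the piece `u '' V` (resp. `v '' V`) of the image
`pairImage u v = range u ∪ {v 0}` is cut out of the whole image by an open set `W` of `X`:
`pairImage u v ∩ W = u '' V` with `u z₀ ∈ W` for `z₀ ∈ V` (J7), resp. `= v '' V` with `v 0 ∈ W`
for `0 ∈ V` (J7').

Proof.  The glued map `F : ℂℙ¹ → X` of the pair (`helper_gluedExists`; only continuity of `u`,
`v` and the compatibility `v z = u z⁻¹` are used) has range `pairImage u v` (`helper_gluedRange`)
and is INJECTIVE, because `u` is injective and `v 0 ∉ range u`: two points of the affine chart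
`{w₀ ≠ 0}` with the same value have the same affine coordinate, hence coincide (the affine chart
is injective on its source); a point of the chart and the point at infinity `[0 : 1]` have the
distinct values `u z`, `v 0`; and `[0 : 1]` is the only point off the chart
(`…ComplexProjectiveSpacePositiveAtlas`: `coordNeZero_one_of_not_coordNeZero_zero`,
`affineCoordComplex_one_eq_zero`).  A continuous
injection of the compact `ℂℙ¹` into the Hausdorff `X` is a (closed) EMBEDDING
(`Continuous.isClosedEmbedding`), so the open subset
`S = {p | wᵢ(p) ≠ 0, cᵢ(p) ∈ V}` of `ℂℙ¹` (preimage of the open `V` under the continuous complex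
affine coordinate `cᵢ` of the open chart `{wᵢ ≠ 0}`) is `F ⁻¹' W` for some open `W ⊆ X`
(`IsInducing.isOpen_iff`), and then `range F ∩ W = F '' S`, which is `u '' V` for `i = 0` and
`v '' V` for `i = 1` since `F` reads `u`, resp. `v`, in the two charts.

References: D. McDuff, D. Salamon, *J-holomorphic Curves and Symplectic Topology*, 2nd ed. (2012),
§2.5–§2.6 (embedded curves, local normal form of the image); Griffiths–Harris, *Principles of
Algebraic Geometry*, Ch. 0 §2 (affine charts of `ℙⁿ`).
-/

noncomputable section

open scoped Manifold ContDiff Topology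
open Set Function Topology Literature.Topology.FourManifolds
  Literature.Topology.FourManifolds.ComplexProjectiveSpace Literature.Geometry.Symplectic

-- the prescribed namespace `Summit.<P>.<Sub>.…` duplicates `SmoothPoincare4` (P = Sub)
set_option linter.dupNamespace false

namespace Summit.SmoothPoincare4.SmoothPoincare4.Theorems.GromovRecognitionRelEnd.CrossCapLaurent

namespace EmbeddedLocalImage

open GluedBasics

/-! ### Points of `ℂℙ¹` through an affine chart -/

/-- Two points of the `i`-th affine chart of `ℂℙ¹` with the same complex affine coordinate
coincide (both are the inverse chart of that coordinate). [folklore] -/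
theorem locImg_eq_of_affineCoordComplex_eq (i : Fin (1 + 1)) {p q : ComplexProjectiveSpace 1}
    (hp : CoordNeZero i p) (hq : CoordNeZero i q)
    (h : affineCoordComplex i p 0 = affineCoordComplex i q 0) : p = q := by
  rw [← affineChart_symm_affineCoordComplex hp, h, affineChart_symm_affineCoordComplex hq]

/-! ### Injectivity of the glued map of an embedded pair -/

/-- The glued map `F : ℂℙ¹ → X` of a two-chart pair `(u, v)` with `u` injective and `v 0 ∉ range u`
is injective: on the chart `{w₀ ≠ 0}` it is `u` of the (injective) affine coordinate, the only
other point `[0 : 1]` goes to `v 0 ∉ range u`. [folklore] -/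
theorem locImg_glued_injective {X : Type*} {u v : ℂ → X} {F : ComplexProjectiveSpace 1 → X}
    (h0 : ∀ p, CoordNeZero 0 p → F p = u (affineCoordComplex 0 p 0))
    (h1 : ∀ p, CoordNeZero 1 p → F p = v (affineCoordComplex 1 p 0))
    (hu : Injective u) (hv : v 0 ∉ range u) : Injective F := by
  intro p q hpq
  by_cases hp : CoordNeZero 0 p <;> by_cases hq : CoordNeZero 0 q
  · rw [h0 p hp, h0 q hq] at hpq
    exact locImg_eq_of_affineCoordComplex_eq 0 hp hq (hu hpq)
  · rw [h0 p hp, glued_apply_of_not_coordNeZero h1 hq] at hpq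
    exact absurd ⟨_, hpq⟩ hv
  · rw [glued_apply_of_not_coordNeZero h1 hp, h0 q hq] at hpq
    exact absurd ⟨_, hpq.symm⟩ hv
  · exact locImg_eq_of_affineCoordComplex_eq 1 (coordNeZero_one_of_not_coordNeZero_zero hp)
      (coordNeZero_one_of_not_coordNeZero_zero hq)
      (by rw [affineCoordComplex_one_eq_zero hp, affineCoordComplex_one_eq_zero hq])

/-! ### The local image through one chart -/

/-- For an INJECTIVE continuous `F : ℂℙ¹ → X`, `X` Hausdorff, reading `g` in the `i`-th affine
chart (`F p = g (cᵢ p)` for `wᵢ(p) ≠ 0`), and an open `V ⊆ ℂ`, some open `W ⊆ X` contains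
`g '' V` and cuts exactly `g '' V` out of `range F`: `F` is an embedding of the compact `ℂℙ¹`
(`Continuous.isClosedEmbedding`), and the open `{p | wᵢ(p) ≠ 0, cᵢ(p) ∈ V}` is the `F`-preimage
of an open `W`. [folklore] -/
theorem locImg_chart {X : Type*} [TopologicalSpace X] [T2Space X]
    (F : C(ComplexProjectiveSpace 1, X)) (hF : Injective F) (i : Fin (1 + 1)) {g : ℂ → X}
    (hg : ∀ p, CoordNeZero i p → F p = g (affineCoordComplex i p 0)) {V : Set ℂ}
    (hV : IsOpen V) : ∃ W : Set X, IsOpen W ∧ g '' V ⊆ W ∧ range F ∩ W = g '' V := by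
  -- the open piece of `ℂℙ¹` parametrising `g '' V`
  set S : Set (ComplexProjectiveSpace 1) :=
    {p | CoordNeZero i p} ∩ (fun p => affineCoordComplex i p 0) ⁻¹' V
  have hS : IsOpen S :=
    ((continuous_apply 0).comp_continuousOn (continuousOn_affineCoordComplex i))
      |>.isOpen_inter_preimage (isOpen_setOf_coordNeZero i) hV
  -- the chart-`i` point of coordinate `z` lies in `S` for `z ∈ V`, with value `g z`
  have hι_mem : ∀ z ∈ V, mk (homogenize i fun _ : Fin 1 => z) ∈ S := fun z hz =>
    ⟨coordNeZero_mk_homogenize i _, by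
      simp only [mem_preimage, affineCoordComplex_mk_homogenize]; exact hz⟩
  have hι_val : ∀ z, F (mk (homogenize i fun _ : Fin 1 => z)) = g z := fun z => by
    rw [hg _ (coordNeZero_mk_homogenize i _), affineCoordComplex_mk_homogenize]
  -- `F` is an embedding, so `S = F ⁻¹' W` for an open `W`
  have hemb : IsClosedEmbedding F := F.continuous.isClosedEmbedding hF
  obtain ⟨W, hW, hWS⟩ := hemb.isInducing.isOpen_iff.1 hS
  have hgW : g '' V ⊆ W := by
    rintro _ ⟨z, hz, rfl⟩
    rw [← hι_val z]
    exact (show mk (homogenize i fun _ : Fin 1 => z) ∈ F ⁻¹' W by rw [hWS]; exact hι_mem z hz)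
  refine ⟨W, hW, hgW, Subset.antisymm ?_ fun y hy => ⟨?_, hgW hy⟩⟩
  · rintro _ ⟨⟨p, rfl⟩, hpW⟩
    have hpS : p ∈ S := by rw [← hWS]; exact hpW
    exact ⟨_, hpS.2, (hg p hpS.1).symm⟩
  · obtain ⟨z, -, rfl⟩ := hy
    exact ⟨_, hι_val z⟩

/-- The common core of J7 and J7': for a continuous compatible pair `(u, v)` with `u` injective
and `v 0 ∉ range u`, and an open `V ⊆ ℂ`, both `u '' V` and `v '' V` are cut out of
`pairImage u v` by open sets of `X` containing them. [folklore] -/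
theorem locImg_pair {X : Type} [TopologicalSpace X] [T2Space X] {u v : ℂ → X}
    (hu : Continuous u) (hv : Continuous v) (hc : ∀ z : ℂ, z ≠ 0 → v z = u z⁻¹)
    (hinj : Injective u) (hinf : v 0 ∉ range u) {V : Set ℂ} (hV : IsOpen V) :
    (∃ W : Set X, IsOpen W ∧ u '' V ⊆ W ∧ pairImage u v ∩ W = u '' V) ∧
      ∃ W : Set X, IsOpen W ∧ v '' V ⊆ W ∧ pairImage u v ∩ W = v '' V := by
  obtain ⟨F, h0, h1⟩ := helper_gluedExists X u v hu hv hc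
  have hrange : pairImage u v = range F := by
    rw [pairImage_eq, helper_gluedRange X u v F hc h0 h1]
  have hF : Injective F := locImg_glued_injective h0 h1 hinj hinf
  rw [hrange]
  exact ⟨locImg_chart F hF 0 h0 hV, locImg_chart F hF 1 h1 hV⟩

end EmbeddedLocalImage

open EmbeddedLocalImage

/-- **J7: local image of an embedded sphere in the affine chart** (registered stub
`helper_embeddedLocalImage` of line `cross-cap-laurent`, signature verbatim).  For an embedded
smooth two-chart sphere `(u, v)` in the Hausdorff manifold `X` and an open `V ∋ z₀`, some open
`W ∋ u z₀` of `X` satisfies `pairImage u v ∩ W = u '' V`: the glued map `ℂℙ¹ → X` is a continuous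
injection of a compact space into a Hausdorff space, hence an embedding, and `u '' V` is the image
of an open subset of `ℂℙ¹` (McDuff–Salamon 2012, §2.5). [folklore] -/
theorem helper_embeddedLocalImage : ∀ (X : Type) [TopologicalSpace X] [T2Space X]
    [ChartedSpace (EuclideanSpace ℝ (Fin 4)) X] [IsManifold (𝓡 4) ∞ X]
    (JX : ∀ y : X, TangentSpace (𝓡 4) y →L[ℝ] TangentSpace (𝓡 4) y) (u v : ℂ → X) (z₀ : ℂ),
    TwoChartSphere JX u v → IsEmbeddedPair u v →
    ∀ V : Set ℂ, IsOpen V → z₀ ∈ V → ∃ W : Set X, IsOpen W ∧ u z₀ ∈ W ∧ pairImage u v ∩ W = u '' V := by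
  intro X _ _ _ _ JX u v z₀ huv hemb V hV hz₀
  obtain ⟨⟨W, hW, hVW, hWV⟩, -⟩ := locImg_pair huv.smooth_u.continuous huv.smooth_v.continuous
    huv.compat hemb.injective hemb.infty_notMem hV
  exact ⟨W, hW, hVW ⟨z₀, hz₀, rfl⟩, hWV⟩

/-- **J7': local image of an embedded sphere at the point at infinity** (registered stub
`helper_embeddedLocalImageInfty` of line `cross-cap-laurent`, signature verbatim).  For an
embedded smooth two-chart sphere `(u, v)` in the Hausdorff manifold `X` and an open `V ∋ 0`, some
open `W ∋ v 0` of `X` satisfies `pairImage u v ∩ W = v '' V` (same embedding argument, read in the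
chart at infinity). [folklore] -/
theorem helper_embeddedLocalImageInfty : ∀ (X : Type) [TopologicalSpace X] [T2Space X]
    [ChartedSpace (EuclideanSpace ℝ (Fin 4)) X] [IsManifold (𝓡 4) ∞ X]
    (JX : ∀ y : X, TangentSpace (𝓡 4) y →L[ℝ] TangentSpace (𝓡 4) y) (u v : ℂ → X),
    TwoChartSphere JX u v → IsEmbeddedPair u v →
    ∀ V : Set ℂ, IsOpen V → (0 : ℂ) ∈ V → ∃ W : Set X, IsOpen W ∧ v 0 ∈ W ∧ pairImage u v ∩ W = v '' V := by
  intro X _ _ _ _ JX u v huv hemb V hV h0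
  obtain ⟨-, W, hW, hVW, hWV⟩ := locImg_pair huv.smooth_u.continuous huv.smooth_v.continuous
    huv.compat hemb.injective hemb.infty_notMem hV
  exact ⟨W, hW, hVW ⟨0, h0, rfl⟩, hWV⟩

end Summit.SmoothPoincare4.SmoothPoincare4.Theorems.GromovRecognitionRelEnd.CrossCapLaurent

end
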